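import Summits.CriticalPhenomena.PercolationContinuityZ3.Theorems.Transplant.FKConnectivityAllQAntipodalAnd4Path
import HarnessLib

/-!
# Connectivity correlation inequalities for `φ_{w,q}`, every `q > 0` — file 31a: side inputs for the 3-STAR `S = K₁,₃ = {ao, ob, oc}`: the
# |W| = 3 drift of two inner edges, the `ob`-CONTRACTED star drift (Duffin re-rooting), and the star drift when the virtual root edge `om` is
# ALREADY an edge

Support file (`--supports stmt-CriticalPhenomena-4575`), FK sub-lane `prim-bschramm-fk-2` (gen 19) of the post-continuity programme; builds
on p205010 (kernel theorem, internal audit signed; external expert review pending).  No definitions, no named facts, no sorries; standard axioms.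

The recursion of file 31 (`and_star3_series_nonpos`: the AND-drift of the star `{ao, ob, oc}` across a series root `E₁(o,m) · E₂(m,b)` of `H \ ob`
is controlled by the SMALLER STAR `{ao, om, oc}` on `E₁`, the pair `{ao, oc}` on `E₁`, and Theorem U on `E₂`) and the R-extension theorem of file
29 need the following inputs, supplied here for EVERY two-terminal series–parallel network (no induction), by gen 11's one-edge theorems inside
the completed graph, which is TTSP between the ends of each of its edges (Duffin; `IsTTSP.insert_edge_of_mem`):
* `FK.and_pair_side_nonpos` — `K = N ∪ {uv, xy}` TTSP between `s, t`, `uv ≠ xy ∉ N`: the |W| = 3 / two-edge AND-drift of `{uv, xy}` on `N` is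
  `≤ 0` (`apPsi_two_edges_eq`, `apPsi_edge_nonpos_of_isTTSP` in the ambient `K ∪ {st}`, bridge);
* `FK.andc_star_side_nonpos` — `K = N ∪ {ao, oc}` TTSP between `o, b`, `ob ∉ K`: the `ob`-CONTRACTED star drift
  `∑_{γ⊆N} (q^{k(γ∪S)+k((N\γ)∪ob)} - q^{k((N\γ)∪S)+k(γ∪ob)}) h(γ) ≤ 0` (contracted bridge with `S' = {ao, oc}`, `C = {ob}`; `apPsiC_two_edges_eq`;
  `apPsiC_edge_nonpos_of_isTTSP` in `K ∪ {ob}`);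
* `FK.and_star3_side_of_mem` — the star drift of `{ao, om, oc}` on `N₁ ∋ om` (`E₁ = N₁ ∪ {ao, oc}` TTSP between `o, m`; the virtual root edge
  doubles a real one) is `≤ 0` PROVIDED the star drift on `N₁ \ om` is (the recursive input): split by the `om`-coordinate = [star on `N₁ \ om`
  against `h(· ∪ om)`] + [`om`-contracted pair drift of `{ao, oc}` against `h`] + [`∑ (q^{Z̄'+G'} - q^{Z̄'+B'})(h(γ'∪om) - h(γ'))`], three nonpositive terms;
[cite: Grimmett2006, §1.4 eq. (1.20) (p. 15); §3.8 Thm. (3.90) (pp. 61–62); §3.9 (pp. 63–64)] [cite: Wagner2006, Thm. 5.8(d), §5.3]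
-/

noncomputable section

namespace Summit.CriticalPhenomena.PercolationContinuityZ3.Theorems

namespace FK

open SimpleGraph Literature.Probability.LatticeModels Literature.Probability.Percolation
open scoped Classical

variable {V : Type*} [Fintype V]

/-! ### The pair and the contracted star -/

section Sides

variable {o a b c m s t u v x y : V}

/-- **Two inner edges (|W| = 3 or two-edge AND-drift).**  `K = N ∪ {uv, xy}` TTSP between `s, t`, `uv ≠ xy`, both off `N`: for every `h` monotone
on the subsets of `N` and `0 < q ≤ 1`, `∑_{γ ⊆ N} (q^{k(γ ∪ {uv,xy}) + k(N\γ)} - q^{k((N\γ) ∪ {uv,xy}) + k(γ)}) h(γ) ≤ 0` — `apPsi_two_edges_eq` and the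
one-edge theorem at `uv` and at `xy`, each inside the completed graph `K ∪ {st}` (TTSP between the ends of every edge, Duffin), through the bridge.
[cite: Grimmett2006, §3.9 (pp. 63–64)] [cite: Wagner2006, Thm. 5.8(d), §5.3] -/
theorem and_pair_side_nonpos {q : ℝ} (hq0 : 0 < q) (hq1 : q ≤ 1) {N : Finset (Sym2 V)}
    (hK : IsTTSP (insert s(u, v) (insert s(x, y) N)) s t) (huvN : s(u, v) ∉ N) (hxyN : s(x, y) ∉ N) (hne : s(u, v) ≠ s(x, y))
    {h : Finset (Sym2 V) → ℝ} (hmono : ∀ ⦃A B : Finset (Sym2 V)⦄, A ⊆ B → B ⊆ N → h A ≤ h B) :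
    ∑ γ ∈ N.powerset,
        (q ^ (clusterCount (↑(γ ∪ {s(u, v), s(x, y)}) : BondConfig V) ∅ + clusterCount (↑(N \ γ) : BondConfig V) ∅) -
            q ^ (clusterCount (↑(N \ γ ∪ {s(u, v), s(x, y)}) : BondConfig V) ∅ + clusterCount (↑γ : BondConfig V) ∅)) * h γ ≤ 0 := by
  set K := insert s(u, v) (insert s(x, y) N) with hKdef
  have hEuv : IsTTSP (insert s(s, t) K) u v := hK.insert_edge_of_mem (Finset.mem_insert_of_mem (Finset.mem_insert_self _ _))
  have hExy : IsTTSP (insert s(s, t) K) x y :=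
    hK.insert_edge_of_mem (Finset.mem_insert_of_mem (Finset.mem_insert_of_mem (Finset.mem_insert_self _ _)))
  set G : Finset (Sym2 V) → ℝ := fun X => h (X ∩ N) with hG
  have hGmono : ∀ ⦃A B : Finset (Sym2 V)⦄, A ⊆ B → G A ≤ G B := fun A B hAB =>
    hmono (Finset.inter_subset_inter hAB le_rfl) Finset.inter_subset_right
  have hGuv : ∀ A : Finset (Sym2 V), G (insert s(u, v) A) = G A := fun A => by
    simp only [hG, Finset.insert_inter_of_notMem huvN]
  have hGxy : ∀ A : Finset (Sym2 V), G (insert s(x, y) A) = G A := fun A => by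
    simp only [hG, Finset.insert_inter_of_notMem hxyN]
  have huvM : s(u, v) ∉ insert s(x, y) N := by rw [Finset.mem_insert, not_or]; exact ⟨hne, huvN⟩
  have hxyM : s(x, y) ∉ insert s(u, v) N := by rw [Finset.mem_insert, not_or]; exact ⟨fun hh => hne hh.symm, hxyN⟩
  have hx : apPsi q (insert s(u, v) (insert s(x, y) N)) (fun A => if s(u, v) ∈ A then 1 else 0) G ≤ 0 :=
    apPsi_edge_nonpos_of_isTTSP hq0 hq1 hEuv ((Finset.subset_insert _ _).trans (Finset.subset_insert _ _)) huvM hGuv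
      fun A B hAB _ => hGmono hAB
  have hy : apPsi q (insert s(u, v) (insert s(x, y) N)) (fun A => if s(x, y) ∈ A then 1 else 0) G ≤ 0 := by
    rw [Finset.insert_comm]
    exact apPsi_edge_nonpos_of_isTTSP hq0 hq1 hExy
      ((Finset.insert_subset_insert _ (Finset.subset_insert _ _)).trans (Finset.subset_insert _ _)) hxyM hGxy
      fun A B hAB _ => hGmono hAB
  have h2 := apPsi_two_edges_eq q (E := insert s(u, v) (insert s(x, y) N)) (x := s(u, v)) (y := s(x, y))
    (Finset.mem_insert_self _ _) (Finset.mem_insert_of_mem (Finset.mem_insert_self _ _)) G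
  have hNS : Disjoint N ({s(u, v), s(x, y)} : Finset (Sym2 V)) := by
    rw [Finset.disjoint_insert_right, Finset.disjoint_singleton_right]; exact ⟨huvN, hxyN⟩
  have hg' : ∀ A T : Finset (Sym2 V), T ⊆ {s(u, v), s(x, y)} → G (A ∪ T) = G A := by
    intro A T hT
    simp only [hG, Finset.union_inter_distrib_right]
    have : T ∩ N = ∅ := Finset.disjoint_iff_inter_eq_empty.1 (Finset.disjoint_of_subset_left hT hNS.symm)
    rw [this, Finset.union_empty]
  have key := apPsi_andInd_eq q hNS ⟨s(u, v), Finset.mem_insert_self _ _⟩ hg'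
  have hE' : N ∪ {s(u, v), s(x, y)} = insert s(u, v) (insert s(x, y) N) := by rw [union_pair_eq_insert, Finset.insert_comm]
  have hf : (fun A : Finset (Sym2 V) => if ({s(u, v), s(x, y)} : Finset (Sym2 V)) ⊆ A then (1 : ℝ) else 0) =
      fun A => if s(u, v) ∈ A ∧ s(x, y) ∈ A then 1 else 0 := by
    funext A; simp only [Finset.insert_subset_iff, Finset.singleton_subset_iff]
  rw [hE', hf, h2] at key
  have hsum : ∑ γ ∈ N.powerset,
      (q ^ (clusterCount (↑(γ ∪ {s(u, v), s(x, y)}) : BondConfig V) ∅ + clusterCount (↑(N \ γ) : BondConfig V) ∅) -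
          q ^ (clusterCount (↑(N \ γ ∪ {s(u, v), s(x, y)}) : BondConfig V) ∅ + clusterCount (↑γ : BondConfig V) ∅)) * h γ =
      ∑ γ ∈ N.powerset, (q ^ (clusterCount (↑(γ ∪ {s(u, v), s(x, y)}) : BondConfig V) ∅ + clusterCount (↑(N \ γ) : BondConfig V) ∅) -
          q ^ (clusterCount (↑(N \ γ ∪ {s(u, v), s(x, y)}) : BondConfig V) ∅ + clusterCount (↑γ : BondConfig V) ∅)) * G γ := by
    refine Finset.sum_congr rfl fun γ hγ => ?_
    rw [Finset.mem_powerset] at hγ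
    simp only [hG, Finset.inter_eq_left.2 hγ]
  rw [hsum]
  linarith

omit [Fintype V] in
/-- Finset bookkeeping: `X ∪ {ao, oc} ∪ {ob} = X ∪ {ao, ob, oc}`. [folklore] -/
theorem union_pair_union_hub_eq (X : Finset (Sym2 V)) (o a b c : V) :
    X ∪ {s(a, o), s(o, c)} ∪ {s(o, b)} = X ∪ {s(a, o), s(o, b), s(o, c)} := by
  ext e
  simp only [Finset.mem_union, Finset.mem_insert, Finset.mem_singleton]
  tauto

/-- **The `ob`-contracted star drift is `≤ 0` on every two-terminal series–parallel network between `o, b` through the star edges.**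
`K = N ∪ {ao, oc}` TTSP between `o, b`, `ao ≠ oc` off `N`, `ob ∉ K`: for every `h` monotone on the subsets of `N` and `0 < q ≤ 1`,
`∑_{γ ⊆ N} (q^{k(γ∪S) + k((N\γ)∪ob)} - q^{k((N\γ)∪S) + k(γ∪ob)}) h(γ) ≤ 0`, `S = {ao, ob, oc}` — the AND of `{ao, oc}` on the minor `K/ob`: the
contracted bridge (`S' = {ao, oc}`, `C = {ob}`), `apPsiC_two_edges_eq`, and `apPsiC_edge_nonpos_of_isTTSP` inside `K ∪ {ob}` (TTSP between `a, o`
and between `o, c` by Duffin's lemma). [cite: Grimmett2006, §3.9 (pp. 63–64)] [cite: Wagner2006, Thm. 5.8(d), §5.3] -/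
theorem andc_star_side_nonpos {q : ℝ} (hq0 : 0 < q) (hq1 : q ≤ 1) {N : Finset (Sym2 V)}
    (hK : IsTTSP (insert s(a, o) (insert s(o, c) N)) o b) (haoN : s(a, o) ∉ N) (hocN : s(o, c) ∉ N)
    (hne : s(a, o) ≠ s(o, c)) (hobK : s(o, b) ∉ insert s(a, o) (insert s(o, c) N))
    {h : Finset (Sym2 V) → ℝ} (hmono : ∀ ⦃A B : Finset (Sym2 V)⦄, A ⊆ B → B ⊆ N → h A ≤ h B) :
    ∑ γ ∈ N.powerset,
        (q ^ (clusterCount (↑(γ ∪ {s(a, o), s(o, b), s(o, c)}) : BondConfig V) ∅ +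
              clusterCount (↑(N \ γ ∪ {s(o, b)}) : BondConfig V) ∅) -
          q ^ (clusterCount (↑(N \ γ ∪ {s(a, o), s(o, b), s(o, c)}) : BondConfig V) ∅ +
              clusterCount (↑(γ ∪ {s(o, b)}) : BondConfig V) ∅)) * h γ ≤ 0 := by
  -- the completed graph is TTSP between the ends of each star edge (Duffin)
  have hHao : IsTTSP (insert s(o, b) (insert s(a, o) (insert s(o, c) N))) a o :=
    hK.insert_edge_of_mem (Finset.mem_insert_of_mem (Finset.mem_insert_self _ _))
  have hHoc : IsTTSP (insert s(o, b) (insert s(a, o) (insert s(o, c) N))) o c :=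
    hK.insert_edge_of_mem (Finset.mem_insert_of_mem (Finset.mem_insert_of_mem (Finset.mem_insert_self _ _)))
  have hobN : s(o, b) ∉ N := fun hh => hobK (Finset.mem_insert_of_mem (Finset.mem_insert_of_mem hh))
  have haoC : s(a, o) ∉ ({s(o, b)} : Finset (Sym2 V)) := by
    rw [Finset.mem_singleton]; intro hh; exact hobK (hh ▸ Finset.mem_insert_self _ _)
  have hocC : s(o, c) ∉ ({s(o, b)} : Finset (Sym2 V)) := by
    rw [Finset.mem_singleton]; intro hh
    exact hobK (hh ▸ Finset.mem_insert_of_mem (Finset.mem_insert_self _ _))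
  have haoMx : s(a, o) ∉ insert s(o, c) N := by rw [Finset.mem_insert, not_or]; exact ⟨hne, haoN⟩
  have hocMy : s(o, c) ∉ insert s(a, o) N := by rw [Finset.mem_insert, not_or]; exact ⟨fun hh => hne hh.symm, hocN⟩
  have hM₁ : insert s(o, c) N ⊆ insert s(o, b) (insert s(a, o) (insert s(o, c) N)) :=
    (Finset.subset_insert _ _).trans (Finset.subset_insert _ _)
  have hM₂ : insert s(a, o) N ⊆ insert s(o, b) (insert s(a, o) (insert s(o, c) N)) :=
    (Finset.insert_subset_insert _ (Finset.subset_insert _ _)).trans (Finset.subset_insert _ _)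
  have hC : ({s(o, b)} : Finset (Sym2 V)) ⊆ insert s(o, b) (insert s(a, o) (insert s(o, c) N)) :=
    Finset.singleton_subset_iff.2 (Finset.mem_insert_self _ _)
  -- the extended test function
  set G : Finset (Sym2 V) → ℝ := fun X => h (X ∩ N) with hG
  have hGmono : ∀ ⦃A B : Finset (Sym2 V)⦄, A ⊆ B → G A ≤ G B := fun A B hAB =>
    hmono (Finset.inter_subset_inter hAB le_rfl) Finset.inter_subset_right
  have hGao : ∀ A : Finset (Sym2 V), G (insert s(a, o) A) = G A := fun A => by
    simp only [hG, Finset.insert_inter_of_notMem haoN]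
  have hGoc : ∀ A : Finset (Sym2 V), G (insert s(o, c) A) = G A := fun A => by
    simp only [hG, Finset.insert_inter_of_notMem hocN]
  have hx : apPsiC q (insert s(a, o) (insert s(o, c) N)) {s(o, b)} (fun A => if s(a, o) ∈ A then 1 else 0) G ≤ 0 :=
    apPsiC_edge_nonpos_of_isTTSP hq0 hq1 hHao hM₁ hC haoMx haoC hGao fun A B hAB _ => hGmono hAB
  have hy : apPsiC q (insert s(a, o) (insert s(o, c) N)) {s(o, b)} (fun A => if s(o, c) ∈ A then 1 else 0) G ≤ 0 := by
    rw [Finset.insert_comm]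
    exact apPsiC_edge_nonpos_of_isTTSP hq0 hq1 hHoc hM₂ hC hocMy hocC hGoc fun A B hAB _ => hGmono hAB
  have h2 := apPsiC_two_edges_eq q (E := insert s(a, o) (insert s(o, c) N)) (C := {s(o, b)})
    (Finset.mem_insert_self _ _) (Finset.mem_insert_of_mem (Finset.mem_insert_self _ _)) haoC hocC G
  have hNS : Disjoint N ({s(a, o), s(o, c)} : Finset (Sym2 V)) := by
    rw [Finset.disjoint_insert_right, Finset.disjoint_singleton_right]; exact ⟨haoN, hocN⟩
  have hSC : Disjoint ({s(a, o), s(o, c)} : Finset (Sym2 V)) {s(o, b)} := by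
    rw [Finset.disjoint_singleton_right, Finset.mem_insert, Finset.mem_singleton, not_or]
    exact ⟨fun hh => haoC (Finset.mem_singleton.2 hh.symm), fun hh => hocC (Finset.mem_singleton.2 hh.symm)⟩
  have hg' : ∀ A T : Finset (Sym2 V), T ⊆ {s(a, o), s(o, c)} → G (A ∪ T) = G A := by
    intro A T hT
    simp only [hG, Finset.union_inter_distrib_right]
    have : T ∩ N = ∅ := Finset.disjoint_iff_inter_eq_empty.1 (Finset.disjoint_of_subset_left hT hNS.symm)
    rw [this, Finset.union_empty]
  have key := apPsiC_andInd_eq q hNS ⟨s(a, o), Finset.mem_insert_self _ _⟩ hSC hg'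
  have hE' : N ∪ {s(a, o), s(o, c)} = insert s(a, o) (insert s(o, c) N) := by
    rw [union_pair_eq_insert, Finset.insert_comm]
  have hf : (fun A : Finset (Sym2 V) => if ({s(a, o), s(o, c)} : Finset (Sym2 V)) ⊆ A then (1 : ℝ) else 0) =
      fun A => if s(a, o) ∈ A ∧ s(o, c) ∈ A then 1 else 0 := by
    funext A
    simp only [Finset.insert_subset_iff, Finset.singleton_subset_iff]
  rw [hE', hf, h2] at key
  have hsum : ∑ γ ∈ N.powerset,
      (q ^ (clusterCount (↑(γ ∪ {s(a, o), s(o, b), s(o, c)}) : BondConfig V) ∅ + clusterCount (↑(N \ γ ∪ {s(o, b)}) : BondConfig V) ∅) -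
        q ^ (clusterCount (↑(N \ γ ∪ {s(a, o), s(o, b), s(o, c)}) : BondConfig V) ∅ + clusterCount (↑(γ ∪ {s(o, b)}) : BondConfig V) ∅)) * h γ =
      ∑ γ ∈ N.powerset,
      (q ^ (clusterCount (↑(γ ∪ {s(a, o), s(o, c)} ∪ {s(o, b)}) : BondConfig V) ∅ + clusterCount (↑(N \ γ ∪ {s(o, b)}) : BondConfig V) ∅) -
        q ^ (clusterCount (↑(N \ γ ∪ {s(a, o), s(o, c)} ∪ {s(o, b)}) : BondConfig V) ∅ + clusterCount (↑(γ ∪ {s(o, b)}) : BondConfig V) ∅)) *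
          G (γ ∪ {s(o, b)}) := by
    refine Finset.sum_congr rfl fun γ hγ => ?_
    rw [Finset.mem_powerset] at hγ
    rw [union_pair_union_hub_eq, union_pair_union_hub_eq]
    have hGγ : G (γ ∪ {s(o, b)}) = h γ := by
      simp only [hG, Finset.union_inter_distrib_right, Finset.inter_eq_left.2 hγ,
        Finset.singleton_inter_of_notMem hobN, Finset.union_empty]
    rw [hGγ]
  rw [hsum]
  linarith

/-- **The star drift when the virtual root edge doubles a real one.**  `E₁ = N₁ ∪ {ao, oc}` TTSP between `o, m` with `ao ≠ oc` off `N₁` and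
`om ∈ N₁`; suppose the star drift of `S₁ = {ao, om, oc}` on `N₁ \ om` is `≤ 0` on every monotone test function (the recursive input).  Then for
every `h` monotone on the subsets of `N₁` and `0 < q ≤ 1`: `∑_{γ ⊆ N₁} (q^{k(γ∪S₁)+k(N₁\γ)} - q^{k((N₁\γ)∪S₁)+k(γ)}) h(γ) ≤ 0`.  With `N' = N₁ \ om`,
`Z' = k(γ'∪S₁)`, `G' = k(γ')`, `B' = k(γ'∪om) ≤ G'`: the sum is `∑(q^{Z'+Ḡ'}-q^{Z̄'+G'})h(γ'∪om) + ∑(q^{Z'+B̄'}-q^{Z̄'+B'})h(γ') + ∑(q^{Z̄'+G'}-q^{Z̄'+B'})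
(h(γ'∪om)-h(γ'))` — [recursive input] + [`om`-contracted pair drift of `{ao, oc}`: contracted bridge, `apPsiC_two_edges_eq`, `apPsiC_edge_nonpos_of_isTTSP`
in `E₁` (TTSP between `a, o` and `o, c` by Duffin, `om ∈ E₁`)] + [pointwise `≤ 0`]. [cite: Grimmett2006, §3.9 (pp. 63–64)] [cite: Wagner2006, Thm. 5.8(d), §5.3] -/
theorem and_star3_side_of_mem {q : ℝ} (hq0 : 0 < q) (hq1 : q ≤ 1) {N₁ : Finset (Sym2 V)}
    (hE : IsTTSP (insert s(a, o) (insert s(o, c) N₁)) o m) (haoN : s(a, o) ∉ N₁) (hocN : s(o, c) ∉ N₁) (hne : s(a, o) ≠ s(o, c))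
    (homN : s(o, m) ∈ N₁)
    (hrec : ∀ h' : Finset (Sym2 V) → ℝ, (∀ ⦃A B : Finset (Sym2 V)⦄, A ⊆ B → B ⊆ N₁.erase s(o, m) → h' A ≤ h' B) →
      ∑ γ ∈ (N₁.erase s(o, m)).powerset,
        (q ^ (clusterCount (↑(γ ∪ {s(a, o), s(o, m), s(o, c)}) : BondConfig V) ∅ + clusterCount (↑(N₁.erase s(o, m) \ γ) : BondConfig V) ∅) -
          q ^ (clusterCount (↑(N₁.erase s(o, m) \ γ ∪ {s(a, o), s(o, m), s(o, c)}) : BondConfig V) ∅ +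
            clusterCount (↑γ : BondConfig V) ∅)) * h' γ ≤ 0)
    {h : Finset (Sym2 V) → ℝ} (hmono : ∀ ⦃A B : Finset (Sym2 V)⦄, A ⊆ B → B ⊆ N₁ → h A ≤ h B) :
    ∑ γ ∈ N₁.powerset,
        (q ^ (clusterCount (↑(γ ∪ {s(a, o), s(o, m), s(o, c)}) : BondConfig V) ∅ + clusterCount (↑(N₁ \ γ) : BondConfig V) ∅) -
            q ^ (clusterCount (↑(N₁ \ γ ∪ {s(a, o), s(o, m), s(o, c)}) : BondConfig V) ∅ + clusterCount (↑γ : BondConfig V) ∅)) * h γ ≤ 0 := by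
  set N' := N₁.erase s(o, m) with hN'
  have hN₁ : N₁ = insert s(o, m) N' := (Finset.insert_erase homN).symm
  have homN' : s(o, m) ∉ N' := Finset.notMem_erase _ _
  have haoN' : s(a, o) ∉ N' := fun hh => haoN (Finset.mem_of_mem_erase hh)
  have hocN' : s(o, c) ∉ N' := fun hh => hocN (Finset.mem_of_mem_erase hh)
  have hN'N : N' ⊆ N₁ := Finset.erase_subset _ _
  have hom_ao : s(o, m) ≠ s(a, o) := fun hh => haoN (hh ▸ homN)
  have hom_oc : s(o, m) ≠ s(o, c) := fun hh => hocN (hh ▸ homN)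
  have homE : s(o, m) ∈ insert s(a, o) (insert s(o, c) N₁) := Finset.mem_insert_of_mem (Finset.mem_insert_of_mem homN)
  -- `E₁` is TTSP between `a, o` and between `o, c` (Duffin; `om ∈ E₁`)
  have hEao : IsTTSP (insert s(a, o) (insert s(o, c) N₁)) a o := by
    have key := hE.insert_edge_of_mem (x := a) (y := o) (Finset.mem_insert_of_mem (Finset.mem_insert_self _ _))
    rwa [Finset.insert_eq_of_mem homE] at key
  have hEoc : IsTTSP (insert s(a, o) (insert s(o, c) N₁)) o c := by
    have key := hE.insert_edge_of_mem (x := o) (y := c)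
      (Finset.mem_insert_of_mem (Finset.mem_insert_of_mem (Finset.mem_insert_self _ _)))
    rwa [Finset.insert_eq_of_mem homE] at key
  -- the star configurations with and without the real edge `om` coincide
  have e3 : ∀ γ : Finset (Sym2 V), insert s(o, m) γ ∪ {s(a, o), s(o, m), s(o, c)} = γ ∪ {s(a, o), s(o, m), s(o, c)} := fun γ => by
    ext e; simp only [Finset.mem_union, Finset.mem_insert, Finset.mem_singleton]; tauto
  -- (1) the recursive input against `h(· ∪ om)`
  have hZ : ∑ γ ∈ N'.powerset,
      (q ^ (clusterCount (↑(γ ∪ {s(a, o), s(o, m), s(o, c)}) : BondConfig V) ∅ + clusterCount (↑(N' \ γ) : BondConfig V) ∅) -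
          q ^ (clusterCount (↑(N' \ γ ∪ {s(a, o), s(o, m), s(o, c)}) : BondConfig V) ∅ + clusterCount (↑γ : BondConfig V) ∅)) *
        h (insert s(o, m) γ) ≤ 0 :=
    hrec (fun γ => h (insert s(o, m) γ)) fun A B hAB hB =>
      hmono (Finset.insert_subset_insert _ hAB) (Finset.insert_subset homN (hB.trans hN'N))
  -- (2) the `om`-contracted pair drift of `{ao, oc}` on `N'` against `h`
  have hC : ∑ γ ∈ N'.powerset,
      (q ^ (clusterCount (↑(γ ∪ {s(a, o), s(o, m), s(o, c)}) : BondConfig V) ∅ +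
            clusterCount (↑(insert s(o, m) (N' \ γ)) : BondConfig V) ∅) -
          q ^ (clusterCount (↑(N' \ γ ∪ {s(a, o), s(o, m), s(o, c)}) : BondConfig V) ∅ +
            clusterCount (↑(insert s(o, m) γ) : BondConfig V) ∅)) * h γ ≤ 0 := by
    set G : Finset (Sym2 V) → ℝ := fun X => h (X ∩ N') with hG
    have hGmono : ∀ ⦃A B : Finset (Sym2 V)⦄, A ⊆ B → G A ≤ G B := fun A B hAB =>
      hmono (Finset.inter_subset_inter hAB le_rfl) (Finset.inter_subset_right.trans hN'N)
    have hGao : ∀ A : Finset (Sym2 V), G (insert s(a, o) A) = G A := fun A => by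
      simp only [hG, Finset.insert_inter_of_notMem haoN']
    have hGoc : ∀ A : Finset (Sym2 V), G (insert s(o, c) A) = G A := fun A => by
      simp only [hG, Finset.insert_inter_of_notMem hocN']
    have haoC : s(a, o) ∉ ({s(o, m)} : Finset (Sym2 V)) := by rw [Finset.mem_singleton]; exact fun hh => hom_ao hh.symm
    have hocC : s(o, c) ∉ ({s(o, m)} : Finset (Sym2 V)) := by rw [Finset.mem_singleton]; exact fun hh => hom_oc hh.symm
    have hCsub : ({s(o, m)} : Finset (Sym2 V)) ⊆ insert s(a, o) (insert s(o, c) N₁) := Finset.singleton_subset_iff.2 homE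
    have haoMx : s(a, o) ∉ insert s(o, c) N' := by rw [Finset.mem_insert, not_or]; exact ⟨hne, haoN'⟩
    have hocMy : s(o, c) ∉ insert s(a, o) N' := by rw [Finset.mem_insert, not_or]; exact ⟨fun hh => hne hh.symm, hocN'⟩
    have hM₁ : insert s(o, c) N' ⊆ insert s(a, o) (insert s(o, c) N₁) :=
      (Finset.insert_subset_insert _ hN'N).trans (Finset.subset_insert _ _)
    have hM₂ : insert s(a, o) N' ⊆ insert s(a, o) (insert s(o, c) N₁) :=
      Finset.insert_subset_insert _ (hN'N.trans (Finset.subset_insert _ _))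
    have hx : apPsiC q (insert s(a, o) (insert s(o, c) N')) {s(o, m)} (fun A => if s(a, o) ∈ A then 1 else 0) G ≤ 0 :=
      apPsiC_edge_nonpos_of_isTTSP hq0 hq1 hEao hM₁ hCsub haoMx haoC hGao fun A B hAB _ => hGmono hAB
    have hy : apPsiC q (insert s(a, o) (insert s(o, c) N')) {s(o, m)} (fun A => if s(o, c) ∈ A then 1 else 0) G ≤ 0 := by
      rw [Finset.insert_comm]
      exact apPsiC_edge_nonpos_of_isTTSP hq0 hq1 hEoc hM₂ hCsub hocMy hocC hGoc fun A B hAB _ => hGmono hAB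
    have h2 := apPsiC_two_edges_eq q (E := insert s(a, o) (insert s(o, c) N')) (C := {s(o, m)})
      (Finset.mem_insert_self _ _) (Finset.mem_insert_of_mem (Finset.mem_insert_self _ _)) haoC hocC G
    have hNS : Disjoint N' ({s(a, o), s(o, c)} : Finset (Sym2 V)) := by
      rw [Finset.disjoint_insert_right, Finset.disjoint_singleton_right]; exact ⟨haoN', hocN'⟩
    have hSC : Disjoint ({s(a, o), s(o, c)} : Finset (Sym2 V)) {s(o, m)} := by
      rw [Finset.disjoint_singleton_right, Finset.mem_insert, Finset.mem_singleton, not_or]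
      exact ⟨hom_ao, hom_oc⟩
    have hg' : ∀ A T : Finset (Sym2 V), T ⊆ {s(a, o), s(o, c)} → G (A ∪ T) = G A := by
      intro A T hT
      simp only [hG, Finset.union_inter_distrib_right]
      have : T ∩ N' = ∅ := Finset.disjoint_iff_inter_eq_empty.1 (Finset.disjoint_of_subset_left hT hNS.symm)
      rw [this, Finset.union_empty]
    have key := apPsiC_andInd_eq q hNS ⟨s(a, o), Finset.mem_insert_self _ _⟩ hSC hg'
    have hE' : N' ∪ {s(a, o), s(o, c)} = insert s(a, o) (insert s(o, c) N') := by
      rw [union_pair_eq_insert, Finset.insert_comm]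
    have hf : (fun A : Finset (Sym2 V) => if ({s(a, o), s(o, c)} : Finset (Sym2 V)) ⊆ A then (1 : ℝ) else 0) =
        fun A => if s(a, o) ∈ A ∧ s(o, c) ∈ A then 1 else 0 := by
      funext A
      simp only [Finset.insert_subset_iff, Finset.singleton_subset_iff]
    rw [hE', hf, h2] at key
    have e4 : ∀ X : Finset (Sym2 V), X ∪ {s(a, o), s(o, c)} ∪ {s(o, m)} = X ∪ {s(a, o), s(o, m), s(o, c)} := fun X => by
      ext e; simp only [Finset.mem_union, Finset.mem_insert, Finset.mem_singleton]; tauto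
    have hsum : ∑ γ ∈ N'.powerset,
        (q ^ (clusterCount (↑(γ ∪ {s(a, o), s(o, m), s(o, c)}) : BondConfig V) ∅ +
              clusterCount (↑(insert s(o, m) (N' \ γ)) : BondConfig V) ∅) -
            q ^ (clusterCount (↑(N' \ γ ∪ {s(a, o), s(o, m), s(o, c)}) : BondConfig V) ∅ +
              clusterCount (↑(insert s(o, m) γ) : BondConfig V) ∅)) * h γ =
        ∑ γ ∈ N'.powerset,
        (q ^ (clusterCount (↑(γ ∪ {s(a, o), s(o, c)} ∪ {s(o, m)}) : BondConfig V) ∅ + clusterCount (↑(N' \ γ ∪ {s(o, m)}) : BondConfig V) ∅) -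
          q ^ (clusterCount (↑(N' \ γ ∪ {s(a, o), s(o, c)} ∪ {s(o, m)}) : BondConfig V) ∅ + clusterCount (↑(γ ∪ {s(o, m)}) : BondConfig V) ∅)) *
            G (γ ∪ {s(o, m)}) := by
      refine Finset.sum_congr rfl fun γ hγ => ?_
      rw [Finset.mem_powerset] at hγ
      rw [e4, e4, union_singleton_eq_insert, union_singleton_eq_insert]
      have hGγ : G (insert s(o, m) γ) = h γ := by
        simp only [hG, Finset.insert_inter_of_notMem homN', Finset.inter_eq_left.2 hγ]
      rw [hGγ]
    rw [hsum]
    linarith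
  -- (3) split the sum over `N₁ = N' ∪ {om}` by the `om`-coordinate
  rw [hN₁, Finset.sum_powerset_insert homN']
  have e1 : ∀ γ ∈ N'.powerset, insert s(o, m) N' \ γ = insert s(o, m) (N' \ γ) := fun γ hγ =>
    Finset.insert_sdiff_of_notMem _ (fun hh => homN' (Finset.mem_powerset.1 hγ hh))
  have e2 : ∀ γ : Finset (Sym2 V), insert s(o, m) N' \ insert s(o, m) γ = N' \ γ := fun γ => by
    rw [Finset.insert_sdiff_insert, Finset.sdiff_insert_of_notMem homN']
  have hS1 : ∑ γ ∈ N'.powerset,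
      (q ^ (clusterCount (↑(γ ∪ {s(a, o), s(o, m), s(o, c)}) : BondConfig V) ∅ +
            clusterCount (↑(insert s(o, m) N' \ γ) : BondConfig V) ∅) -
          q ^ (clusterCount (↑(insert s(o, m) N' \ γ ∪ {s(a, o), s(o, m), s(o, c)}) : BondConfig V) ∅ +
            clusterCount (↑γ : BondConfig V) ∅)) * h γ =
      ∑ γ ∈ N'.powerset,
      (q ^ (clusterCount (↑(γ ∪ {s(a, o), s(o, m), s(o, c)}) : BondConfig V) ∅ +
            clusterCount (↑(insert s(o, m) (N' \ γ)) : BondConfig V) ∅) -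
          q ^ (clusterCount (↑(N' \ γ ∪ {s(a, o), s(o, m), s(o, c)}) : BondConfig V) ∅ + clusterCount (↑γ : BondConfig V) ∅)) * h γ := by
    refine Finset.sum_congr rfl fun γ hγ => ?_
    rw [e1 γ hγ, e3 (N' \ γ)]
  have hS2 : ∑ γ ∈ N'.powerset,
      (q ^ (clusterCount (↑(insert s(o, m) γ ∪ {s(a, o), s(o, m), s(o, c)}) : BondConfig V) ∅ +
            clusterCount (↑(insert s(o, m) N' \ insert s(o, m) γ) : BondConfig V) ∅) -
          q ^ (clusterCount (↑(insert s(o, m) N' \ insert s(o, m) γ ∪ {s(a, o), s(o, m), s(o, c)}) : BondConfig V) ∅ +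
            clusterCount (↑(insert s(o, m) γ) : BondConfig V) ∅)) * h (insert s(o, m) γ) =
      ∑ γ ∈ N'.powerset,
      (q ^ (clusterCount (↑(γ ∪ {s(a, o), s(o, m), s(o, c)}) : BondConfig V) ∅ + clusterCount (↑(N' \ γ) : BondConfig V) ∅) -
          q ^ (clusterCount (↑(N' \ γ ∪ {s(a, o), s(o, m), s(o, c)}) : BondConfig V) ∅ +
            clusterCount (↑(insert s(o, m) γ) : BondConfig V) ∅)) * h (insert s(o, m) γ) := by
    refine Finset.sum_congr rfl fun γ _ => ?_
    rw [e2 γ, e3 γ]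
  rw [hS1, hS2]
  -- (4) the remainder is pointwise nonpositive
  have hB : ∀ γ : Finset (Sym2 V), q ^ clusterCount (↑γ : BondConfig V) ∅ ≤ q ^ clusterCount (↑(insert s(o, m) γ) : BondConfig V) ∅ := by
    intro γ
    have i := clusterCount_insert_add_ite γ o m
    exact pow_le_pow_of_le_one hq0.le hq1 (by omega)
  have rem : ∑ γ ∈ N'.powerset,
      (q ^ (clusterCount (↑(N' \ γ ∪ {s(a, o), s(o, m), s(o, c)}) : BondConfig V) ∅ + clusterCount (↑γ : BondConfig V) ∅) -
        q ^ (clusterCount (↑(N' \ γ ∪ {s(a, o), s(o, m), s(o, c)}) : BondConfig V) ∅ +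
          clusterCount (↑(insert s(o, m) γ) : BondConfig V) ∅)) * (h (insert s(o, m) γ) - h γ) ≤ 0 := by
    refine Finset.sum_nonpos fun γ hγ => ?_
    rw [Finset.mem_powerset] at hγ
    refine mul_nonpos_of_nonpos_of_nonneg ?_ (sub_nonneg.2 (hmono (Finset.subset_insert _ _) (Finset.insert_subset homN (hγ.trans hN'N))))
    rw [pow_add, pow_add]
    exact sub_nonpos.2 (mul_le_mul_of_nonneg_left (hB γ) (pow_nonneg hq0.le _))
  have split : ∑ γ ∈ N'.powerset,
        (q ^ (clusterCount (↑(γ ∪ {s(a, o), s(o, m), s(o, c)}) : BondConfig V) ∅ +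
              clusterCount (↑(insert s(o, m) (N' \ γ)) : BondConfig V) ∅) -
            q ^ (clusterCount (↑(N' \ γ ∪ {s(a, o), s(o, m), s(o, c)}) : BondConfig V) ∅ + clusterCount (↑γ : BondConfig V) ∅)) * h γ +
      ∑ γ ∈ N'.powerset,
        (q ^ (clusterCount (↑(γ ∪ {s(a, o), s(o, m), s(o, c)}) : BondConfig V) ∅ + clusterCount (↑(N' \ γ) : BondConfig V) ∅) -
            q ^ (clusterCount (↑(N' \ γ ∪ {s(a, o), s(o, m), s(o, c)}) : BondConfig V) ∅ +
              clusterCount (↑(insert s(o, m) γ) : BondConfig V) ∅)) * h (insert s(o, m) γ) =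
      ∑ γ ∈ N'.powerset,
        (q ^ (clusterCount (↑(γ ∪ {s(a, o), s(o, m), s(o, c)}) : BondConfig V) ∅ + clusterCount (↑(N' \ γ) : BondConfig V) ∅) -
            q ^ (clusterCount (↑(N' \ γ ∪ {s(a, o), s(o, m), s(o, c)}) : BondConfig V) ∅ + clusterCount (↑γ : BondConfig V) ∅)) *
          h (insert s(o, m) γ) +
      ∑ γ ∈ N'.powerset,
        (q ^ (clusterCount (↑(γ ∪ {s(a, o), s(o, m), s(o, c)}) : BondConfig V) ∅ +
              clusterCount (↑(insert s(o, m) (N' \ γ)) : BondConfig V) ∅) -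
            q ^ (clusterCount (↑(N' \ γ ∪ {s(a, o), s(o, m), s(o, c)}) : BondConfig V) ∅ +
              clusterCount (↑(insert s(o, m) γ) : BondConfig V) ∅)) * h γ +
      ∑ γ ∈ N'.powerset,
        (q ^ (clusterCount (↑(N' \ γ ∪ {s(a, o), s(o, m), s(o, c)}) : BondConfig V) ∅ + clusterCount (↑γ : BondConfig V) ∅) -
          q ^ (clusterCount (↑(N' \ γ ∪ {s(a, o), s(o, m), s(o, c)}) : BondConfig V) ∅ +
            clusterCount (↑(insert s(o, m) γ) : BondConfig V) ∅)) * (h (insert s(o, m) γ) - h γ) := by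
    rw [← Finset.sum_add_distrib, ← Finset.sum_add_distrib, ← Finset.sum_add_distrib]
    refine Finset.sum_congr rfl fun γ _ => ?_
    ring
  rw [split]
  linarith

end Sides

end FK

end Summit.CriticalPhenomena.PercolationContinuityZ3.Theorems

end
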